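import Mathlib.Analysis.SpecialFunctions.Log.Basic
import Literature.NumberTheory.Transcendental.BakerLogarithmsConclusion

/-!
# Baker's theorem for real logarithms: linear independence over the real algebraic numbers

Baker's Theorem 2.1 is proved in the tree in its natural complex form
(`Literature.NumberTheory.Transcendental.baker_holds`, `bakerFin_holds`, file
`BakerLogarithmsConclusion.lean`): for complex `l₁, …, lₙ` with `e^{lᵢ}` algebraic and
`l₁, …, lₙ` linearly independent over `ℚ`, the family `1, l₁, …, lₙ` is linearly independent over
the field `ℚ̄ = algebraicClosure ℚ ℂ` of all algebraic numbers.

Its users on the real line — e.g. the values `r + Σⱼ cⱼ log aⱼ` (`r, cⱼ, aⱼ` real algebraic,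
`aⱼ > 0`) of one-dimensional period integrals with real algebraic poles — want the REAL form, whose
natural field of scalars is the field `algebraicClosure ℚ ℝ` of real algebraic numbers (the
intermediate field of `ℝ / ℚ` used throughout the tree for "real algebraic"). This file derives
that form once and for all, by a descent of scalars, so that real arguments need not pass through
`ℂ`:

* `linearIndependent_algebraicClosure_of_ofReal` — descent: a family of real numbers whose
  complexification is linearly independent over `algebraicClosure ℚ ℂ` is linearly independent
  over `algebraicClosure ℚ ℝ` (a real algebraic relation IS a `ℚ̄`-relation, with the same
  coefficients);
* `baker_real` — **Theorem 2.1 over `ℝ`**: for real `l i` with `Real.exp (l i)` algebraic and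
  `l` linearly independent over `ℚ`, the family `1, (l i)ᵢ` (indexed by `Option ι`, `none ↦ 1`)
  is linearly independent over `algebraicClosure ℚ ℝ`;
* `baker_real_log` — the same for `l i = Real.log (ε i)` with `ε i > 0` real algebraic;
* `baker_real_coeff` — the coefficient form for a finite index type: a relation
  `β₀ + Σᵢ βᵢ lᵢ = 0` with real algebraic `β₀, βᵢ` forces `β₀ = 0` and all `βᵢ = 0`.

Everything here is a corollary of the proved `baker_holds`; no definitions and no named facts are
introduced. Deliberately NOT here: quantitative lower bounds for real linear forms (see
`BakerLinearFormsQuantitative.lean`), and logarithms of negative reals (`Real.log x = log |x|` is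
a junk extension we do not want in hypotheses; users pass `|x|` or `0 < x`).

Source: A. Baker, *Transcendental Number Theory*, Cambridge Univ. Press (1975), Ch. 2,
Theorem 2.1.
-/

noncomputable section

open Complex

namespace Literature.NumberTheory.Transcendental

/-! ### Descent of scalars from `ℚ̄ ⊂ ℂ` to the real algebraic numbers -/

/-- **Descent of scalars.** If a family of real numbers `v i` becomes linearly independent over
`ℚ̄ = algebraicClosure ℚ ℂ` after the coercion `ℝ → ℂ`, then it is linearly independent over the
field `algebraicClosure ℚ ℝ` of real algebraic numbers: a finite relation `Σ gᵢ vᵢ = 0` with real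
algebraic `gᵢ`, read in `ℂ`, is a relation whose coefficients `(gᵢ : ℂ)` lie in `ℚ̄`. [folklore] -/
theorem linearIndependent_algebraicClosure_of_ofReal {ι : Type*} {v : ι → ℝ}
    (h : LinearIndependent (algebraicClosure ℚ ℂ) fun i => ((v i : ℝ) : ℂ)) :
    LinearIndependent (algebraicClosure ℚ ℝ) v := by
  rw [linearIndependent_iff'] at h ⊢
  intro s g hg i hi
  -- the real algebraic coefficients, complexified, lie in `ℚ̄`
  have hmem : ∀ j, (((g j : ℝ) : ℝ) : ℂ) ∈ algebraicClosure ℚ ℂ := fun j =>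
    mem_algebraicClosure_iff.mpr (mem_algebraicClosure_iff.mp (g j).2).algebraMap
  -- the relation, read in `ℂ`
  have hsum : ∑ j ∈ s, (⟨((g j : ℝ) : ℂ), hmem j⟩ : algebraicClosure ℚ ℂ) • ((v j : ℝ) : ℂ) = 0 := by
    have hC := congrArg (fun t : ℝ => (t : ℂ)) hg
    simp only [IntermediateField.smul_def, smul_eq_mul, Complex.ofReal_sum, Complex.ofReal_mul,
      Complex.ofReal_zero] at hC
    simpa only [IntermediateField.smul_def, smul_eq_mul] using hC
  have h0 := congrArg Subtype.val (h s _ hsum i hi)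
  exact Subtype.ext (Complex.ofReal_eq_zero.mp h0)

/-! ### Theorem 2.1 over the reals -/

/-- **Baker's theorem, real form** (Baker 1975, Theorem 2.1, for real logarithms). If `l i` are
real numbers with `Real.exp (l i)` algebraic (real logarithms of positive real algebraic numbers)
and the `l i` are linearly independent over `ℚ`, then `1, (l i)ᵢ` — the family indexed by
`Option ι`, `none ↦ 1`, `some i ↦ l i` — is linearly independent over the field
`algebraicClosure ℚ ℝ` of real algebraic numbers. Proof: `baker_holds` at the complexified `l i`
(`e^{(l i : ℂ)} = (Real.exp (l i) : ℂ)` is algebraic; `ℚ`-independence transfers along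
`re ∘ ofReal = id`), then descent of scalars. [cite: Baker1975, Theorem 2.1] -/
theorem baker_real {ι : Type*} (l : ι → ℝ) (halg : ∀ i, IsAlgebraic ℚ (Real.exp (l i)))
    (hli : LinearIndependent ℚ l) :
    LinearIndependent (algebraicClosure ℚ ℝ) fun o : Option ι => o.elim (1 : ℝ) l := by
  -- hypotheses of the complex theorem at `(l i : ℂ)`
  have halgC : ∀ i, IsAlgebraic ℚ (cexp ((l i : ℝ) : ℂ)) := fun i => by
    rw [← Complex.ofReal_exp]
    exact (halg i).algebraMap
  have hliC : LinearIndependent ℚ fun i => ((l i : ℝ) : ℂ) := by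
    refine LinearIndependent.of_comp (Complex.reLm.restrictScalars ℚ) ?_
    convert hli using 1
    funext i
    simp
  -- Baker in `ℂ`, then descent
  refine linearIndependent_algebraicClosure_of_ofReal ?_
  convert baker_holds (fun i => ((l i : ℝ) : ℂ)) halgC hliC using 1
  funext o
  cases o <;> simp

/-- **Baker's theorem, real form, for logarithms of positive algebraic numbers.** If `ε i > 0`
are real algebraic numbers whose logarithms `Real.log (ε i)` are linearly independent over `ℚ`,
then `1, (log ε i)ᵢ` (indexed by `Option ι`, `none ↦ 1`) is linearly independent over the field
`algebraicClosure ℚ ℝ` of real algebraic numbers. [cite: Baker1975, Theorem 2.1] -/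
theorem baker_real_log {ι : Type*} (ε : ι → ℝ) (hε : ∀ i, 0 < ε i)
    (halg : ∀ i, IsAlgebraic ℚ (ε i)) (hli : LinearIndependent ℚ fun i => Real.log (ε i)) :
    LinearIndependent (algebraicClosure ℚ ℝ)
      fun o : Option ι => o.elim (1 : ℝ) fun i => Real.log (ε i) :=
  baker_real _ (fun i => by rw [Real.exp_log (hε i)]; exact halg i) hli

/-! ### Coefficient form -/

/-- **Baker's theorem, real coefficient form.** If `l i` (`i` in a finite index type) are real
numbers with `Real.exp (l i)` algebraic, linearly independent over `ℚ`, and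
`β₀ + Σᵢ βᵢ · l i = 0` with REAL ALGEBRAIC `β₀, βᵢ`, then `β₀ = 0` and every `βᵢ = 0`: the
relation is a finite linear relation over `algebraicClosure ℚ ℝ` among `1, (l i)ᵢ`, which are
independent by `baker_real`. [cite: Baker1975, Theorem 2.1] -/
theorem baker_real_coeff {ι : Type*} [Fintype ι] (l : ι → ℝ)
    (halg : ∀ i, IsAlgebraic ℚ (Real.exp (l i))) (hli : LinearIndependent ℚ l)
    {β₀ : ℝ} (hβ₀ : IsAlgebraic ℚ β₀) {β : ι → ℝ} (hβ : ∀ i, IsAlgebraic ℚ (β i))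
    (h : β₀ + ∑ i, β i * l i = 0) : β₀ = 0 ∧ ∀ i, β i = 0 := by
  have hB := Fintype.linearIndependent_iff.mp (baker_real l halg hli)
    (fun o => o.elim ⟨β₀, mem_algebraicClosure_iff.mpr hβ₀⟩
      fun i => ⟨β i, mem_algebraicClosure_iff.mpr (hβ i)⟩)
    (by
      rw [Fintype.sum_option]
      simpa only [Option.elim_none, Option.elim_some, IntermediateField.smul_def, smul_eq_mul,
        mul_one] using h)
  exact ⟨congrArg Subtype.val (hB none), fun i => congrArg Subtype.val (hB (some i))⟩

end Literature.NumberTheory.Transcendental
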